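import Summits.QuantumFields.YangMills.Theorems.BalabanUVNodesN15KingModelCovariantBlockPositivity
import Summits.QuantumFields.YangMills.Theorems.BalabanUVNodesN15KingModelTorusPlaneWaves
import Literature.LinearAlgebra.Matrix.RayleighQuotient
import Mathlib.Analysis.SpecialFunctions.Trigonometric.Bounds
import HarnessLib

/-!
# BalabanUVNodes ∕ N15 — THE KING-MODEL RUNG (PART Ϥ-f): ★★★ THE PRICE OF ROUGH FIELDS — a link field at which the full operator `A₀(U) = −cΔ_U + m² + aQ(U)^*Q(U)` has an
# eigenvalue `≤ m² + c·(2−2cos(2π∕L))∕L^d ≤ m² + 4π²c∕L^{d+2}`, whatever `a ≥ 0` is: ONE FLUX QUANTUM SPREAD OVER THE SPINE SHEET OF EVERY BLOCK.  With PART Ϥ-e: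
# `c∕((d+1)L^{d+2}) ≲ inf_U λ_min(−cΔ_U + aQ(U)^*Q(U)) ≤ 4π²c∕L^{d+2}` — the tree floor's order `L^{−(d+2)}` IS SHARP over all unitary link fields; in King's units (`c = L² = η⁻²`)
# the infimum over `U` of the massless floor is `Θ(η^d)`: the η-UNIFORM positivity of [B9] p.395 FAILS over rough fields (it holds in regular gauges, PARTS Ϥ-g∕Ϥ-h)
# (Track A, DAG node N15 = NE2; FAN-OUT v1.1 §N15 s3 «KING-MODEL RUNG … + what the curved case adds»; count-neutral)

HONEST FRAMING.  Count-neutral (cell `pub-ymgap`, seat `pub-ymgap-dag-n15-e` g49; `--supports stmt-QuantumFields-27247 --as helper` = K3ᴬ, KEY MAP v3).  King's comparison model with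
the COMB contours; fibre `ℂⁿ`; an explicit `U(1)`-embedded witness.  The witness is ROUGH: its non-trivial plaquettes carry the angle `2π∕L` — in King's units `2πη`, i.e. physical
curvature `2π∕η → ∞` concentrated on a sheet — far outside Bałaban's regularity class (3.35); so this file does NOT contradict [B9] p.395 l.1–3 («assuming some regularity … Δ′_a is
positive»): it shows the regularity assumption cannot be dropped if the floor is to be `η`-uniform.  NOT a node discharge (N15 of record untouched); nothing continuum ∕ ℝ⁴ ∕ OS ∕ Clay.

THE WITNESS.  Spine momentum `p = M₀e₀` on `T_η = Π_μℤ∕(LM_μ)` (so `χ_p(x) = e^{2πi x₀∕L}` depends only on the axis-0 offset of `x` in its block, and `ψ := χ_p(e₀) = e^{2πi∕L}`).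
Link field `U_w(x,0) = ψ̄·1` on the axis-0 bonds whose source has NON-ZERO TRANSVERSE OFFSET (off the spine line `{j_1 = … = j_d = 0}` of its block), `U_w = 1` on every other bond.
Test vector `v(x) = χ_p(x)ξ`.  (i) Off-spine axis-0 bonds: `v(x) − ψ̄v(x+e₀) = 0`; other axes: `χ_p(x+e_μ) = χ_p(x)`, cost `0`; spine axis-0 bonds (`L` per block): `|1−ψ|²‖ξ‖²` each.  (ii) The
COMB contours never use an off-spine axis-0 bond (Ϥ-b `kingComb_apply_eq_zero_of_lt`: a comb bond along `e₀` starts on the spine), so `U_w(Γ_{y,x}) = 1` for all `x` and `(Q(U_w)v)(y) =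
L^{−(d+1)}ξΣ_jψ^{j₀} = 0` (sum of the `L`-th roots of unity).  Hence ★★★ `Re⟨v,A₀(U_w)v⟩ = (m² + c|1−ψ|²∕L^d)·Σ‖v_x‖²` EXACTLY, `|1−ψ|² = |e^{2πi∕L} − 1|² ≤ 4π²∕L²`.
RESULTS: §1 defs `offsetOf`, `transverse`, `spineMom`, `spinePhase` (`ψ`), `spineFluxLink` (`U_w`), `spineWave` (`v`); `offsetOf_site`, `spineMom_apply_zero∕_of_ne_zero`, `chi_spineMom_unitVec_zero∕_of_ne`,
`chi_spineMom_site` (`= ψ^{j₀}`), `spinePhase_pow_L` (`ψ^L = 1`), `spinePhase_ne_one` (`L ≥ 2`), `card_filter_transverse_eq_zero`, ★ `sum_pow_spinePhase` (`Σ_{t<L}ψ^t = 0`), ★★ `sum_chi_spineMom_site` (`Σ_jχ_p(site y j) = 0`),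
`norm_spinePhase`, `spineFluxLink_mem_unitaryGroup`, `norm_one_sub_spinePhase_le` (`≤ 2π∕L`); §2 ★★ `treeHol_kingComb_spineFluxLink` (`= 1`), ★★ `covQ_spineFluxLink_mulVec_spineWave` (`= 0`), ★★
`bondE_spineFluxLink_spineWave` (the three bond cases), `sum_bondE_spineFluxLink_spineWave`; §3 ★★★ **`re_quadForm_fullOpU_spineWave`** (the exact Rayleigh identity), ★★★
**`exists_eigenvalue_fullOpU_spineFluxLink_le`** (`∃ i, λ_i ≤ m² + 4π²c∕L^{d+2}`), ★★★★ **`king_full_propagator_floor_two_sided`** (Ϥ-e's comb floor below for EVERY `U` and this ceiling at `U_w`: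
the order `c·L^{−(d+2)}` of the `U`-uniform floor is exact), ★★ `king_full_propagator_floor_not_uniform` (for every `γ > 0` independent of `L` there are `L` and a unitary `U` violating it).
PRIOR TREE ART (by name): Ϥ-b (`kingComb`, `kingComb_apply_eq_zero_of_lt`, `treeHol_congr_block`, `treeHol_const_one`), Ϥ-c (`covQ_mulVec_apply`), Ϥ-d (`fullOpU`, `isHermitian_fullOpU`, `re_quadForm_fullOpU`),
Ϥ-e (`eigenvalues_fullOpU_ge_tree`, `treeGap`), Ͱ-b (`fib`, `fib_apply`), Ϳ-b (`bondE`), `B5Prop11Plancherel` (`chi`, `chi_add_right`, `chi_unitVec`), `TorusSpectral.norm_chi_eq_one`, `King1986.Torus` (`site`,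
`blockEquiv`, `card_fine`), `Literature.LinearAlgebra.Matrix.RayleighQuotient` (`exists_eigenvalues_le_and_ge_re_form_div`), Mathlib (`ZMod.stdAddChar`, `geom_sum_eq`,
`Complex.norm_exp_I_mul_ofReal_sub_one_le`, `Fin.consEquiv`).  Dedup (rg at filing): basename 0 files; needles `spineFluxLink|spineWave|spineMom|king_full_propagator_floor_two_sided` 0 files in
`Summits/QuantumFields/YangMills` + `Literature/MathematicalPhysics`.  presearch: «covariant Laplacian block average positivity fails rough gauge field ∕ flux sheet» corpus+galaxy: none
(queries "axial gauge block averaging positivity", "Balaban propagator positivity regularity"; the device is elementary).  Locators: [Balaban1985BackgroundPropagators] (3.19) p.393, (3.24)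
p.394, p.395 l.1–3, (3.35) p.396; [King1986] (2.11)–(2.13) p.653; [HornJohnson2013] Thm 4.2.2.  0 `sorry`.
-/

noncomputable section
open scoped BigOperators ComplexConjugate ComplexOrder Matrix.Norms.L2Operator
open Finset Matrix WithLp Complex

namespace Summit.QuantumFields.YangMills.BalabanUVNodes.N15KingModelRung.CovariantBlock

open Literature.MathematicalPhysics.QuantumFieldTheory.Balaban1983to89.B5Prop11Plancherel (Tor fine unitVec chi chi_add_right chi_unitVec)
open Literature.MathematicalPhysics.QuantumFieldTheory.King1986.Torus (site blockEquiv blockEquiv_apply)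
open Summit.QuantumFields.YangMills.BalabanUVNodes.N15KingModelRung.Covariant (fib fib_apply)
open Summit.QuantumFields.YangMills.BalabanUVNodes.N15KingModelRung.Curvature (bondE)
open Summit.QuantumFields.YangMills.BalabanUVNodes.N15KingModelRung.TorusSpectral (norm_chi_eq_one)
open Literature.LinearAlgebra.Matrix.RayleighQuotient (exists_eigenvalues_le_and_ge_re_form_div)

variable {d : ℕ} (L : ℕ) [NeZero L] (M : Fin (d + 1) → ℕ) [hM : ∀ μ, NeZero (M μ)]
variable {n : Type*} [Fintype n] [DecidableEq n]

/-! ## §1 The spine momentum, the phase `ψ = e^{2πi∕L}`, the witness field and the test wave -/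

/-- The offset `j ∈ {0,…,L−1}^{d+1}` of a fine site in its block (`x = site b j`). [cite: King1986, (2.11) p.653] -/
def offsetOf (x : Tor (fine L M)) : Fin (d + 1) → Fin L := ((blockEquiv L M).symm x).2

/-- The TRANSVERSE part `(j_1,…,j_d)` of an offset (the coordinates beyond the axis `e₀`). [folklore] -/
def transverse (j : Fin (d + 1) → Fin L) : Fin d → Fin L := Fin.tail j

/-- `offsetOf (site b j) = j`. [folklore] -/
@[simp] theorem offsetOf_site (b : Tor M) (j : Fin (d + 1) → Fin L) : offsetOf L M (site L M b j) = j := by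
  rw [offsetOf, ← blockEquiv_apply, Equiv.symm_apply_apply]

/-- THE SPINE MOMENTUM `p = M₀·e₀` on the fine torus: `χ_p(x) = e^{2πi·x₀∕L}` reads the axis-0 offset only. [folklore] -/
def spineMom : Tor (fine L M) := fun ν => (((if ν = 0 then M 0 else 0 : ℕ)) : ZMod (fine L M ν))

/-- THE PHASE `ψ = χ_p(e₀) = e^{2πi∕L}`. [folklore] -/
def spinePhase : ℂ := chi (fine L M) (spineMom L M) (unitVec (fine L M) 0)

/-- ★ THE ROUGH WITNESS FIELD `U_w`: `ψ̄·1` on the axis-0 bonds whose source lies OFF the spine line of its block (non-zero transverse offset), `1` on every other bond — its curved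
plaquettes (angle `2π∕L`) tile the sheets next to the spine lines. [cite: King1986, (2.12) p.653; Balaban1985BackgroundPropagators, (3.35) p.396] -/
def spineFluxLink : Tor (fine L M) × Fin (d + 1) → Matrix n n ℂ :=
  fun b => if b.2 = 0 ∧ transverse L (offsetOf L M b.1) ≠ 0 then (starRingEnd ℂ (spinePhase L M)) • (1 : Matrix n n ℂ) else 1

/-- THE TEST WAVE `v(x) = χ_p(x)·ξ` (a plane wave of spine momentum times a fixed colour vector). [cite: King1986, (4.35) p.674] -/
def spineWave (ξ : n → ℂ) : Tor (fine L M) × n → ℂ := fun xi => chi (fine L M) (spineMom L M) xi.1 * ξ xi.2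

omit [NeZero L] hM in
/-- `p_0 = M₀`. [folklore] -/
theorem spineMom_apply_zero : spineMom L M 0 = ((M 0 : ℕ) : ZMod (fine L M 0)) := by simp [spineMom]

omit [NeZero L] hM in
/-- `p_ν = 0` for `ν ≠ 0`. [folklore] -/
theorem spineMom_apply_of_ne_zero {ν : Fin (d + 1)} (hν : ν ≠ 0) : spineMom L M ν = 0 := by simp [spineMom, hν]

/-- `χ_p(e₀) = ψ`. [folklore] -/
theorem chi_spineMom_unitVec_zero : chi (fine L M) (spineMom L M) (unitVec (fine L M) 0) = spinePhase L M := rfl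

/-- `χ_p(e_μ) = 1` for `μ ≠ 0` (the wave is constant along the transverse axes). [folklore] -/
theorem chi_spineMom_unitVec_of_ne {μ : Fin (d + 1)} (hμ : μ ≠ 0) : chi (fine L M) (spineMom L M) (unitVec (fine L M) μ) = 1 := by
  rw [chi_unitVec, spineMom_apply_of_ne_zero L M hμ, AddChar.map_zero_eq_one]

/-- `ψ = stdAddChar_{LM₀}(M₀)`. [folklore] -/
theorem spinePhase_eq_stdAddChar : spinePhase L M = (ZMod.stdAddChar (N := fine L M 0)) ((M 0 : ℕ) : ZMod (fine L M 0)) := by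
  rw [spinePhase, chi_unitVec, spineMom_apply_zero]

/-- ON A BLOCK POINT THE WAVE IS A POWER OF `ψ`: `χ_p(site b j) = ψ^{j₀}` (the corner contributes `e^{2πi·M₀Lb₀∕(LM₀)} = 1`). [folklore] -/
theorem chi_spineMom_site (b : Tor M) (j : Fin (d + 1) → Fin L) : chi (fine L M) (spineMom L M) (site L M b j) = spinePhase L M ^ ((j 0 : ℕ)) := by
  unfold chi
  rw [Finset.prod_eq_single (0 : Fin (d + 1))]
  · rw [spineMom_apply_zero, spinePhase_eq_stdAddChar, ← AddChar.map_nsmul_eq_pow]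
    congr 1
    simp only [site, nsmul_eq_mul]
    have h0 : (((M 0 : ℕ) : ZMod (fine L M 0)) * ((L * (b 0).val : ℕ) : ZMod (fine L M 0))) = 0 := by
      rw [← Nat.cast_mul, ZMod.natCast_eq_zero_iff]
      exact ⟨(b 0).val, by simp [fine]; ring⟩
    push_cast at h0 ⊢
    linear_combination h0
  · intro ν _ hν
    rw [spineMom_apply_of_ne_zero L M hν, zero_mul, AddChar.map_zero_eq_one]
  · intro h; exact absurd (Finset.mem_univ _) h

/-- `ψ^L = 1` (`L·M₀ ≡ 0`). [folklore] -/
theorem spinePhase_pow_L : spinePhase L M ^ L = 1 := by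
  rw [spinePhase_eq_stdAddChar, ← AddChar.map_nsmul_eq_pow, nsmul_eq_mul, ← Nat.cast_mul,
    (ZMod.natCast_eq_zero_iff _ _).mpr ⟨1, by simp [fine]⟩, AddChar.map_zero_eq_one]

/-- `ψ ≠ 1` for `L ≥ 2` (`M₀` is not a multiple of `LM₀`). [folklore] -/
theorem spinePhase_ne_one (hL : 2 ≤ L) : spinePhase L M ≠ 1 := by
  rw [spinePhase_eq_stdAddChar, ← (ZMod.stdAddChar (N := fine L M 0)).map_zero_eq_one, Ne, ZMod.injective_stdAddChar.eq_iff, ZMod.natCast_eq_zero_iff]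
  intro h
  have hM0 : 0 < M 0 := Nat.pos_of_ne_zero (NeZero.ne (M 0))
  have := Nat.le_of_dvd hM0 h
  simp only [fine] at this
  nlinarith

/-- ★ THE ROOTS OF UNITY SUM TO ZERO: `Σ_{t<L} ψ^t = 0` (`L ≥ 2`). [folklore] -/
theorem sum_pow_spinePhase (hL : 2 ≤ L) : ∑ t : Fin L, spinePhase L M ^ (t : ℕ) = 0 := by
  rw [Fin.sum_univ_eq_sum_range (fun t => spinePhase L M ^ t), geom_sum_eq (spinePhase_ne_one L M hL), spinePhase_pow_L, sub_self, zero_div]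

/-- ★★ **THE BLOCK SUM OF THE WAVE VANISHES**: `Σ_{j ∈ {0..L−1}^{d+1}} χ_p(site b j) = L^d·Σ_{t<L}ψ^t = 0` (`L ≥ 2`). [folklore] -/
theorem sum_chi_spineMom_site (hL : 2 ≤ L) (b : Tor M) : ∑ j : Fin (d + 1) → Fin L, chi (fine L M) (spineMom L M) (site L M b j) = 0 := by
  simp_rw [chi_spineMom_site]
  rw [← (Fin.consEquiv fun _ : Fin (d + 1) => Fin L).sum_comp, Fintype.sum_prod_type]
  simp only [Fin.consEquiv_apply, Fin.cons_zero]
  rw [Finset.sum_comm, Finset.sum_eq_zero]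
  intro r _
  exact sum_pow_spinePhase L M hL

/-- `|ψ| = 1`. [folklore] -/
theorem norm_spinePhase : ‖spinePhase L M‖ = 1 := norm_chi_eq_one (fine L M) _ _

/-- `ψ̄ψ = 1`. [folklore] -/
theorem conj_spinePhase_mul_self : starRingEnd ℂ (spinePhase L M) * spinePhase L M = 1 := by
  rw [← Complex.normSq_eq_conj_mul_self, Complex.normSq_eq_norm_sq, norm_spinePhase]; norm_num

/-- `ψψ̄ = 1`. [folklore] -/
theorem spinePhase_mul_conj_self : spinePhase L M * starRingEnd ℂ (spinePhase L M) = 1 := by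
  rw [mul_comm, conj_spinePhase_mul_self]

/-- The witness field is unitary. [folklore] -/
theorem spineFluxLink_mem_unitaryGroup (bd : Tor (fine L M) × Fin (d + 1)) : spineFluxLink L M (n := n) bd ∈ Matrix.unitaryGroup n ℂ := by
  unfold spineFluxLink
  split_ifs
  · rw [Matrix.mem_unitaryGroup_iff, star_eq_conjTranspose, conjTranspose_smul, conjTranspose_one, Matrix.smul_mul, Matrix.mul_smul, Matrix.one_mul, smul_smul, RCLike.star_def,
      RingHomCompTriple.comp_apply, RingHom.id_apply]
    first
      | rw [spinePhase_mul_conj_self, one_smul]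
      | rw [conj_spinePhase_mul_self, one_smul]
  · exact Submonoid.one_mem _

/-- `|1 − ψ| ≤ 2π∕L` (`ψ = e^{2πi∕L}`; chord ≤ arc). [folklore] -/
theorem norm_one_sub_spinePhase_le : ‖1 - spinePhase L M‖ ≤ 2 * Real.pi / L := by
  have hL : (0 : ℝ) < L := by exact_mod_cast Nat.pos_of_ne_zero (NeZero.ne L)
  have hM0c : ((M 0 : ℕ) : ℂ) ≠ 0 := by exact_mod_cast NeZero.ne (M 0)
  have hLc : ((L : ℕ) : ℂ) ≠ 0 := by exact_mod_cast NeZero.ne L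
  have hψ : spinePhase L M = Complex.exp (Complex.I * ((2 * Real.pi / L : ℝ) : ℂ)) := by
    rw [spinePhase_eq_stdAddChar, show (((M 0 : ℕ)) : ZMod (fine L M 0)) = ((M 0 : ℤ) : ZMod (fine L M 0)) by push_cast; rfl, ZMod.stdAddChar_coe]
    congr 1
    simp only [fine]; push_cast
    field_simp
  rw [norm_sub_rev, hψ]
  calc ‖Complex.exp (Complex.I * ((2 * Real.pi / L : ℝ) : ℂ)) - 1‖ ≤ ‖(2 * Real.pi / L : ℝ)‖ := Real.norm_exp_I_mul_ofReal_sub_one_le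
    _ = 2 * Real.pi / L := by rw [Real.norm_eq_abs, abs_of_nonneg (by positivity)]

/-! ## §2 The comb transports are trivial, the block means vanish, the bond energies -/

variable {L}

/-- ★★ **THE COMB NEVER CROSSES THE FLUX SHEET**: every comb contour bond of `U_w` is flat (a comb bond along `e₀` starts ON the spine, Ϥ-b `kingComb_apply_eq_zero_of_lt`), so
`U_w(Γ_{y,x}) = 1` for all `x`. [cite: Balaban1984PropagatorsI, (1.7) p.18; King1986, (2.12) p.653] -/
theorem treeHol_kingComb_spineFluxLink (b : Tor M) (j : Fin (d + 1) → Fin L) : treeHol M (kingComb d L) (spineFluxLink L M (n := n)) b j = 1 := by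
  have h := treeHol_congr_block (kingComb d L) M (U := spineFluxLink L M (n := n)) (V := fun _ => (1 : Matrix n n ℂ)) b (fun j hj => ?_) j
  · rw [h]; exact treeHol_const_one (kingComb d L) M b j
  · simp only [kingComb_root] at hj
    simp only [spineFluxLink, kingComb_parent, kingComb_axis, offsetOf_site]
    rw [if_neg]
    rintro ⟨hax, htr⟩
    apply htr
    funext ν
    exact (kingComb_apply_eq_zero_of_lt hj (ν := ν.succ) (by rw [hax]; exact Fin.succ_pos ν)).2

/-- ★★ **THE BLOCK MEANS OF THE WAVE VANISH AT THE WITNESS**: `Q(U_w)v = 0` (`L ≥ 2`): trivial transports and `Σ_jχ_p(site y j) = 0`. [cite: Balaban1985BackgroundPropagators, (3.19) p.393] -/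
theorem covQ_spineFluxLink_mulVec_spineWave (hL : 2 ≤ L) (ξ : n → ℂ) : covQ (kingComb d L) M (spineFluxLink L M (n := n)) *ᵥ spineWave L M ξ = 0 := by
  funext ⟨y, i⟩
  rw [covQ_mulVec_apply, Pi.zero_apply]
  simp_rw [treeHol_kingComb_spineFluxLink, Matrix.one_mulVec]
  simp only [spineWave]
  rw [← Finset.sum_mul, sum_chi_spineMom_site L M hL, zero_mul, mul_zero]

omit [Fintype n] [DecidableEq n] in
/-- The fibre of the wave: `v(x) = χ_p(x)·ξ`. [folklore] -/
theorem fib_spineWave (ξ : n → ℂ) (x : Tor (fine L M)) : fib (fine L M) (spineWave L M ξ) x = chi (fine L M) (spineMom L M) x • (toLp 2 ξ : EuclideanSpace ℂ n) := by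
  ext i; simp [spineWave, fib_apply]

omit [DecidableEq n] in
/-- `‖v_x‖ = ‖ξ‖`. [folklore] -/
theorem norm_fib_spineWave (ξ : n → ℂ) (x : Tor (fine L M)) : ‖fib (fine L M) (spineWave L M ξ) x‖ = ‖(toLp 2 ξ : EuclideanSpace ℂ n)‖ := by
  rw [fib_spineWave, norm_smul, norm_chi_eq_one, one_mul]

/-- ★★ **THE BOND ENERGIES OF THE WAVE AT THE WITNESS**: `0` on every bond except the axis-0 bonds starting ON the spine, where it is `|1−ψ|²‖ξ‖²`.
[cite: Balaban1985BackgroundPropagators, (3.23) p.394; King1986, (4.4) p.670] -/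
theorem bondE_spineFluxLink_spineWave (ξ : n → ℂ) (x : Tor (fine L M)) (μ : Fin (d + 1)) :
    bondE (fine L M) (spineFluxLink L M (n := n)) (spineWave L M ξ) x μ
      = if μ = 0 ∧ transverse L (offsetOf L M x) = 0 then ‖1 - spinePhase L M‖ ^ 2 * ‖(toLp 2 ξ : EuclideanSpace ℂ n)‖ ^ 2 else 0 := by
  rw [bondE, fib_spineWave, fib_spineWave, chi_add_right]
  rcases eq_or_ne μ 0 with hμ | hμ
  · subst hμ
    rw [chi_spineMom_unitVec_zero]
    by_cases htr : transverse L (offsetOf L M x) = 0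
    · -- on the spine: `U = 1`, cost `|1 − ψ|²‖ξ‖²`
      rw [if_pos ⟨rfl, htr⟩, spineFluxLink, if_neg (fun h => h.2 htr), Matrix.toLpLin_apply, Matrix.one_mulVec, toLp_ofLp, ← sub_smul, norm_smul, mul_pow, ← mul_one_sub, norm_mul,
        norm_chi_eq_one, one_mul]
    · -- off the spine: `U = ψ̄`, cost `0`
      rw [if_neg (fun h => htr h.2), spineFluxLink, if_pos ⟨rfl, htr⟩, Matrix.toLpLin_apply, Matrix.smul_mulVec, Matrix.one_mulVec, ofLp_smul, smul_smul, toLp_smul, toLp_ofLp, ← sub_smul,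
        show chi (fine L M) (spineMom L M) x - starRingEnd ℂ (spinePhase L M) * (chi (fine L M) (spineMom L M) x * spinePhase L M) = 0 by
          linear_combination (-(chi (fine L M) (spineMom L M) x)) * conj_spinePhase_mul_self L M,
        zero_smul, norm_zero]; simp
  · rw [if_neg (fun h => hμ h.1), chi_spineMom_unitVec_of_ne L M hμ, mul_one, spineFluxLink, if_neg (fun h => hμ h.1), Matrix.toLpLin_apply, Matrix.one_mulVec, toLp_ofLp, sub_self,
      norm_zero]; simp

omit [NeZero L] in
/-- The offsets with vanishing transverse part are the `L` points `(t,0,…,0)` of the spine line. [folklore] -/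
theorem card_filter_transverse_eq_zero [NeZero L] : (univ.filter fun j : Fin (d + 1) → Fin L => transverse L j = 0).card = L := by
  have h : (univ.filter fun j : Fin (d + 1) → Fin L => transverse L j = 0) = univ.image fun t : Fin L => (Fin.cons t (0 : Fin d → Fin L) : Fin (d + 1) → Fin L) := by
    ext j
    simp only [Finset.mem_filter, Finset.mem_univ, true_and, Finset.mem_image]
    constructor
    · intro hj
      refine ⟨j 0, ?_⟩
      rw [transverse] at hj
      rw [← hj]
      exact Fin.cons_self_tail j
    · rintro ⟨t, rfl⟩; simp [transverse]
  rw [h, Finset.card_image_of_injective _ fun t t' htt' => by simpa using congr_fun htt' 0, Finset.card_univ, Fintype.card_fin]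

/-- The number of offsets with vanishing transverse part is `L`. [folklore] -/
theorem sum_offsets_ite_transverse (f : ℝ) : ∑ j : Fin (d + 1) → Fin L, (if transverse L j = 0 then f else 0) = L * f := by
  rw [← Finset.sum_filter, Finset.sum_const, card_filter_transverse_eq_zero, nsmul_eq_mul]

/-- The total bond energy of the wave at the witness: `|T₁|·L·|1−ψ|²‖ξ‖²`. [cite: King1986, (4.4) p.670] -/
theorem sum_bondE_spineFluxLink_spineWave (ξ : n → ℂ) :
    ∑ x, ∑ μ, bondE (fine L M) (spineFluxLink L M (n := n)) (spineWave L M ξ) x μ = Fintype.card (Tor M) * L * (‖1 - spinePhase L M‖ ^ 2 * ‖(toLp 2 ξ : EuclideanSpace ℂ n)‖ ^ 2) := by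
  simp_rw [bondE_spineFluxLink_spineWave]
  have hμ : ∀ x : Tor (fine L M), ∑ μ : Fin (d + 1), (if μ = 0 ∧ transverse L (offsetOf L M x) = 0 then ‖1 - spinePhase L M‖ ^ 2 * ‖(toLp 2 ξ : EuclideanSpace ℂ n)‖ ^ 2 else 0)
      = if transverse L (offsetOf L M x) = 0 then ‖1 - spinePhase L M‖ ^ 2 * ‖(toLp 2 ξ : EuclideanSpace ℂ n)‖ ^ 2 else 0 := by
    intro x
    rw [Finset.sum_eq_single (0 : Fin (d + 1))]
    · simp only [true_and]
    · intro μ _ hμ; rw [if_neg (fun h => hμ h.1)]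
    · intro h; exact absurd (Finset.mem_univ _) h
  simp_rw [hμ]
  rw [← (blockEquiv L M).sum_comp, Fintype.sum_prod_type]
  simp only [blockEquiv_apply, offsetOf_site]
  simp_rw [sum_offsets_ite_transverse]
  rw [Finset.sum_const, Finset.card_univ, nsmul_eq_mul]; ring

/-! ## §3 The Rayleigh identity and the two-sided floor -/

omit [DecidableEq n] in
/-- `Σ_x‖v_x‖² = |T_η|·‖ξ‖²`. [folklore] -/
theorem sum_norm_fib_spineWave_sq (ξ : n → ℂ) : ∑ x, ‖fib (fine L M) (spineWave L M ξ) x‖ ^ 2 = Fintype.card (Tor (fine L M)) * ‖(toLp 2 ξ : EuclideanSpace ℂ n)‖ ^ 2 := by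
  simp_rw [norm_fib_spineWave]; rw [Finset.sum_const, Finset.card_univ, nsmul_eq_mul]

/-- ★★★ **THE EXACT RAYLEIGH IDENTITY AT THE WITNESS**: for `L ≥ 2`, every `a`, `c`, `m²` and colour vector `ξ`:
`Re⟨v, A₀(U_w)v⟩ = (m² + c·|1−ψ|²∕L^d)·Σ_x‖v_x‖²` — the block term contributes NOTHING (`Q(U_w)v = 0`) and only the `L` spine bonds per block are charged.
[cite: Balaban1985BackgroundPropagators, (3.24) p.394, p.395 l.1–3; King1986, (2.13) p.653] -/
theorem re_quadForm_fullOpU_spineWave (hL : 2 ≤ L) (a c m2 : ℝ) (ξ : n → ℂ) :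
    RCLike.re (star (spineWave L M ξ) ⬝ᵥ (fullOpU (kingComb d L) M a c m2 (spineFluxLink L M (n := n)) *ᵥ spineWave L M ξ))
      = (m2 + c * ‖1 - spinePhase L M‖ ^ 2 / (L : ℝ) ^ d) * ∑ x, ‖fib (fine L M) (spineWave L M ξ) x‖ ^ 2 := by
  -- `|T_η| = L^{d+1}|T₁|` (tree `King1986.Torus.card_fine`, real form = `TorusSpectral.card_tor_fine_real`)
  have card_fine_real : (Fintype.card (Tor (fine L M)) : ℝ) = (L : ℝ) ^ (d + 1) * Fintype.card (Tor M) := by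
    exact_mod_cast Literature.MathematicalPhysics.QuantumFieldTheory.King1986.Torus.card_fine L M
  rw [re_quadForm_fullOpU (kingComb d L) M a c m2 (spineFluxLink_mem_unitaryGroup L M) (spineWave L M ξ), covQ_spineFluxLink_mulVec_spineWave M hL ξ,
    sum_bondE_spineFluxLink_spineWave, sum_norm_fib_spineWave_sq, card_fine_real]
  have hL0 : (L : ℝ) ≠ 0 := by exact_mod_cast NeZero.ne L
  have hfib0 : ∀ y : Tor M, ‖fib M (0 : Tor M × n → ℂ) y‖ ^ 2 = 0 := fun y => by
    rw [sq_eq_zero_iff, norm_eq_zero]; ext i; simp [fib_apply]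
  simp_rw [hfib0]
  rw [Finset.sum_const_zero, mul_zero, add_zero, pow_succ]
  field_simp

omit [DecidableEq n] in
/-- `Σ_p‖v_p‖² = Σ_x‖v_x‖²` (the `ℓ²` mass of a field, sitewise). [folklore] -/
theorem sum_norm_sq_eq_sum_norm_fib_sq (v : Tor (fine L M) × n → ℂ) : ∑ p, ‖v p‖ ^ 2 = ∑ x, ‖fib (fine L M) v x‖ ^ 2 := by
  rw [Fintype.sum_prod_type]
  refine Finset.sum_congr rfl fun x _ => ?_
  rw [EuclideanSpace.norm_sq_eq]; rfl

/-- ★★★ **AN EIGENVALUE BELOW `m² + 4π²c∕L^{d+2}` AT THE WITNESS** (`L ≥ 2`, `c ≥ 0`, any `a`, non-trivial fibre): some eigenvalue of `A₀(U_w)` is `≤ m² + c|1−ψ|²∕L^d ≤ m² + 4π²c∕L^{d+2}`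
(Rayleigh, [HornJohnson2013] Thm 4.2.2). [cite: Balaban1985BackgroundPropagators, p.395 l.1–3; HornJohnson2013, Thm 4.2.2] -/
theorem exists_eigenvalue_fullOpU_spineFluxLink_le [Nonempty n] (hL : 2 ≤ L) {c : ℝ} (hc : 0 ≤ c) (a m2 : ℝ) :
    ∃ i, (isHermitian_fullOpU (kingComb d L) M a c m2 (spineFluxLink L M (n := n))).eigenvalues i ≤ m2 + 4 * Real.pi ^ 2 * c / (L : ℝ) ^ (d + 2) := by
  obtain ⟨i₀⟩ := ‹Nonempty n›
  set ξ : n → ℂ := Pi.single i₀ 1 with hξ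
  have hv : spineWave L M ξ ≠ 0 := by
    intro h
    have := congr_fun h ((0 : Tor (fine L M)), i₀)
    simp only [spineWave, hξ, Pi.single_eq_same, mul_one, Pi.zero_apply] at this
    have h1 := norm_chi_eq_one (fine L M) (spineMom L M) 0
    rw [this, norm_zero] at h1
    exact zero_ne_one h1
  obtain ⟨⟨i, hi⟩, -⟩ := exists_eigenvalues_le_and_ge_re_form_div (isHermitian_fullOpU (kingComb d L) M a c m2 (spineFluxLink L M (n := n))) hv
  refine ⟨i, hi.trans ?_⟩
  have hS : 0 < ∑ p, ‖spineWave L M ξ p‖ ^ 2 := (Literature.LinearAlgebra.Matrix.RayleighQuotient.sum_norm_sq_pos_iff _).mpr hv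
  rw [sum_norm_sq_eq_sum_norm_fib_sq] at hS ⊢
  rw [re_quadForm_fullOpU_spineWave M hL a c m2 ξ, mul_div_assoc, div_self hS.ne', mul_one]
  have hL0 : (0 : ℝ) < L := by exact_mod_cast Nat.pos_of_ne_zero (NeZero.ne L)
  have hψ : ‖1 - spinePhase L M‖ ^ 2 ≤ (2 * Real.pi / L) ^ 2 := pow_le_pow_left₀ (norm_nonneg _) (norm_one_sub_spinePhase_le L M) 2
  have : c * ‖1 - spinePhase L M‖ ^ 2 / (L : ℝ) ^ d ≤ c * (2 * Real.pi / L) ^ 2 / (L : ℝ) ^ d := by gcongr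
  calc m2 + c * ‖1 - spinePhase L M‖ ^ 2 / (L : ℝ) ^ d ≤ m2 + c * (2 * Real.pi / L) ^ 2 / (L : ℝ) ^ d := by linarith
    _ = m2 + 4 * Real.pi ^ 2 * c / (L : ℝ) ^ (d + 2) := by rw [pow_succ, pow_succ]; field_simp; ring

/-- ★★★★ **THE `U`-UNIFORM FLOOR OF THE FULL OPERATOR IS OF ORDER `c·L^{−(d+2)}` EXACTLY** (comb contours, `L ≥ 2`, `c ≥ 0`, any `a`, `m²`, every volume, non-trivial fibre):
(FLOOR, Ϥ-e) every eigenvalue of `A₀(U)` at EVERY unitary `U` is `≥ m² + min(a, c∕(L^{d+1}(d+1)(L−1)))`; (CEILING) at the witness `U_w` some eigenvalue is `≤ m² + 4π²c∕L^{d+2}` — for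
`a ≥ c∕(L^{d+1}(d+1)(L−1))` the two differ by the factor `4π²(d+1)L∕(L−1) ≤ 8π²(d+1)` only.  In King's units (`c = L²`): the infimum over `U` of the massless floor is `Θ(L^{−d}) = Θ(η^d)` — NOT
`η`-uniform. [cite: Balaban1985BackgroundPropagators, p.395 l.1–3, (3.24) p.394; King1986, (2.13) p.653; Balaban1984PropagatorsI, (1.7) p.18] -/
theorem king_full_propagator_floor_two_sided [Nonempty n] (hL : 2 ≤ L) {c : ℝ} (hc : 0 ≤ c) (a m2 : ℝ) :
    (∀ U : Tor (fine L M) × Fin (d + 1) → Matrix n n ℂ, (∀ bd, U bd ∈ Matrix.unitaryGroup n ℂ) →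
        ∀ i, m2 + treeGap a c L d ((d + 1) * (L - 1)) ≤ (isHermitian_fullOpU (kingComb d L) M a c m2 U).eigenvalues i)
      ∧ ∃ U : Tor (fine L M) × Fin (d + 1) → Matrix n n ℂ, (∀ bd, U bd ∈ Matrix.unitaryGroup n ℂ) ∧
        ∃ i, (isHermitian_fullOpU (kingComb d L) M a c m2 U).eigenvalues i ≤ m2 + 4 * Real.pi ^ 2 * c / (L : ℝ) ^ (d + 2) :=
  ⟨fun _ hU i => eigenvalues_fullOpU_ge_tree (kingComb d L) M kingComb_depth_le hc a m2 hU i,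
    ⟨spineFluxLink L M, spineFluxLink_mem_unitaryGroup L M, exists_eigenvalue_fullOpU_spineFluxLink_le M hL hc a m2⟩⟩

end Summit.QuantumFields.YangMills.BalabanUVNodes.N15KingModelRung.CovariantBlock

end
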